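import Summits.QuantumFields.YangMills.Theorems.BalabanUVNodesN13UV01LevelZeroOfNormalisationLettersAtRecord13
import Literature.MathematicalPhysics.QuantumFieldTheory.Balaban1983to89.Node00.Record13Chi

/-!
# BalabanUVNodes ∕ N13 → K1ᴬ — THE χ-GENERIC EDITION OF N13's LEVEL-0 FACE OF (UV₁₃): dag-n13-w1's `…N13UV01LevelZeroAtRecord13` §EKeyed, `…OfPartialSumFloorAtRecord13` §1 and
# `…OfNormalisationLettersAtRecord13` §PerStep∕§EBounds∕§LevelZero∕§Bridges — the engine-path rows — with the record's β-slot small-field function a FIXED parameter `(χ : ChiSlot F N)`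
# (WORK ORDER RC-1, director-ym №462 (B) ∕ №467 (D); K1ᴬ stmt-QuantumFields-27239)

TRACK A (YM-PLAN §2d), node N13's level-0 hand-off to the COMPOSITE N24; seat `pub-ymgap-dag-n24-c` g23 (op 5b ENGINE-LANE HAND; dag-lead HANDS-3 (iv) precedent: no live N13 seat, the consumer
types the χ edition; `--kind proof --supports stmt-QuantumFields-27239 --as helper`, count-neutral).

WHY.  The cofinal K1 ENGINE (✓p782234) CONSUMES N13's level-0 row through ONE name, `N13UV01LevelZeroAtThm1CCMWZBOfPrintedZ.uv_zero_densOfRecord₁₃_theta13OfThm1CCMWZB_printedZ_of_eflAbs_of_inInterval_of_runPartialSumFloor`,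
whose proof is the chain below read at the CHOICE-centred β ∕ histories ∕ normalisation ∕ densities (`betaOfRecord₁₃`, `gOfRecord₁₃`, `EOfRecord₁₃`, `densOfRecord₁₃`, `chiβOfRecord₁₃`); the decl-level
census of the K1 chain (`ConeCensusK1.lean`, pub-ymgap INBOX I.22228) lists exactly these 13 rows as the centre-TYPED N13-level-0 constants WITHOUT a χ twin.  This file is their VERBATIM
re-issue under σ_χ (`X₁₃ F N θ ↦ X₁₃Chi F N θ χ` for `beta ∕ g ∕ E ∕ dens`, `chiβOfRecord₁₃ F N θ ↦ χ`; names `X ↦ X_chi`; `[Ax-3b]` `Node00/Record13Chi`: `densOfRecord₁₃_zero_chi`, `gOfRecord₁₃Chi =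
genSeq (betaOfRecord₁₃Chi …)`, `EOfRecord₁₃Chi = Σ eStepOfRecord … (gOfRecord₁₃Chi …)` all definitional), with the ONE genuinely centre-dependent input — `χ₀ ∈ [0, 1]` (parent: K0e's
`chiFix29OfRecord_mem_Icc`) — made a HYPOTHESIS `hχ01 : ∀ K g k V, χ K g k V ∈ [0,1]` of the three rows that read it; every centre-free helper of the parents (`wilsonAction4_le_twelve_mul_card_site`,
`sitesCard_*`, `tstarCount_*`, `sum_sitesCard_succ_range_le`, `zNorm_SU_le_one`, `log_zNorm_SU_nonpos`, `dimSU_le_four_mul`, `log_inv_le_log_inv_add_of_inv_sq_le`,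
`inv_sq_le_inv_sq_zero_add_of_rgEqH_of_partialSumFloor`, `rgEqH_genSeq_of_inInterval`, `rhoZeroOfRecord_le`) is cited BY NAME.  The Ax ∕ printed-z-witness instances follow in the sibling
`…N13UV01LevelZeroAtThm1CCMWZBAxOfPrintedZ`.

WHAT IS HERE (theorems only; 0 `def`, 0 `sorry`, standard axioms): `densOfRecord₁₃_zero_apply_chi` · `uv_upper_zero_of_negE_le_chi` · `uv_lower_zero_of_E_le_chi` (+`hχ01`) ·
`partialSumFloor_nonneg_of_inInterval_chi` · `inv_sq_gOfRecord₁₃_le_of_inInterval_of_runPartialSumFloor_chi` · `eStepOfRecord_eq_of_lt_chi` · `eStepOfRecord_le_of_zLower_of_eflUpper_chi` ·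
`neg_eStepOfRecord_le_of_zUpper_of_eflLower_chi` · `EOfRecord₁₃_le_of_inInterval_of_zLower_of_eflUpper_chi` · `neg_EOfRecord₁₃_le_of_inInterval_of_invSqFloor_of_zUpper_of_eflLower_chi` ·
`uv_zero_densOfRecord₁₃_of_normLetters_of_inInterval_of_invSqFloor_chi` (+`hχ01`) · `zItems_of_logz_eq_log_zNorm_chi` · ★ `uv_zero_densOfRecord₁₃_of_logz_zNorm_of_eflAbs_of_inInterval_of_invSqFloor_chi` (+`hχ01`).

HONEST FRAMING.  Bookkeeping re-issue of elementary level-0 arithmetic ((2.50) at `k = 0` from the normalisation letters); no estimate of Bałaban's beyond what the parents typed; N13 NOT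
discharged; nothing asserted; K1ᴬ DECIDING ∕ OPEN, not claimed; counts unmoved (discharged 8∕27 · K 1∕4); one finite 𝕋⁴ programme at fixed ε = L^{−K} — NOT continuum ∕ ℝ⁴ ∕ OS ∕ mass gap ∕
Clay.  No `def`, no `instance`, no `sorry`.  References (context): [V] = [Balaban1989LargeFieldII] (0.1) pp.355–356; [III] = [Balaban1988Convergent] Thm 1 p.262, (1.15) p.249, (2.50) p.264;
[I] = [Balaban1987RG1] (0.2) p.252, (0.14)–(0.20) pp.254–256, Thm 2 p.259, (2.9) p.266, (2.13)–(2.14) p.268.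
-/

noncomputable section

open scoped BigOperators

namespace Summit.QuantumFields.YangMills.BalabanUVNodes.N13UV01LevelZeroAtRecord13Chi

open MeasureTheory
open Literature.MathematicalPhysics.QuantumFieldTheory.Balaban1983to89
open Literature.MathematicalPhysics.QuantumFieldTheory.Balaban1983to89.T4Continuum
open Literature.MathematicalPhysics.QuantumFieldTheory.Balaban1983to89.Node00
open Literature.MathematicalPhysics.QuantumFieldTheory.Balaban1983to89.FlowStepRuns (genFlow genSeq genSeq_zero)
open Literature.MathematicalPhysics.QuantumFieldTheory.Balaban1983to89.FlowStep (HBeta prefixOf RGEqH inv_sq_telescopeH BetaLowerH)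
open Literature.MathematicalPhysics.QuantumFieldTheory.Balaban1983to89.B12NodeKnitIndAPlug (rgEqH_genSeq_of_inInterval)
open Summit.QuantumFields.YangMills.BalabanUVNodes.N13UV01LevelZeroAtRecord13 (wilsonAction4_le_twelve_mul_card_site)
open Summit.QuantumFields.YangMills.BalabanUVNodes.N13UV01LevelZeroAtRecord13SignFree (log_inv_le_log_inv_add_of_inv_sq_le)
open Summit.QuantumFields.YangMills.BalabanUVNodes.N13UV01LevelZeroOfPartialSumFloorAtRecord13 (inv_sq_le_inv_sq_zero_add_of_rgEqH_of_partialSumFloor)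
open Summit.QuantumFields.YangMills.BalabanUVNodes.N13UV01LevelZeroOfNormalisationLettersAtRecord13
  (sitesCard_sub_succ_eq tstarCount_eq_four_mul_sub sitesCard_sub_succ_nonneg sum_sitesCard_succ_range_le dimSU_le_four_mul zNorm_SU_le_one log_zNorm_SU_nonpos)
open Summit.QuantumFields.YangMills.BalabanUVNodes.N13NormalisationNoGoCouplingBlindAtRecord13SepCoPHV (dimSU_cast)

variable {F : T4Family} {N : ℕ} [NeZero N]

/-! ## §1χ. (UV₁₃) at `k = 0`, E-keyed, χ-generic -/

section EKeyedChi

variable (θ : Stage13Params F N) (χ : ChiSlot F N) (P : B12.RunParams)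

/-- (χ-generic re-issue) -/
theorem densOfRecord₁₃_zero_apply_chi (U : GaugeField (F.P P.K) 0 (SU N)) :
    densOfRecord₁₃Chi F N θ χ P 0 U = Real.exp (-(EOfRecord₁₃Chi F N θ χ P)) * Real.exp (-(P.g0⁻¹ ^ 2) * wilsonAction4 U) := by
  rw [densOfRecord₁₃_zero_chi]
  rfl

/-- **`A(U) ≤ 2·#Plaq(T^{(j)})`** (each Wilson term `1 − Re tr U(∂p) ∈ [0, 2]`, `|Re tr| ≤ 1` on `SU(N)`). [I] (0.2) p.252. -/
theorem uv_upper_zero_of_negE_le_chi {ep : ℝ} (hE : -(EOfRecord₁₃Chi F N θ χ P) ≤ ep * (Fintype.card (Site (F.P P.K) 0) : ℝ)) (U : GaugeField (F.P P.K) 0 (SU N)) :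
    densOfRecord₁₃Chi F N θ χ P 0 U ≤ Real.exp (ep * (Fintype.card (Site (F.P P.K) 0) : ℝ)) := by
  rw [densOfRecord₁₃_zero_chi]
  exact (rhoZeroOfRecord_le F N P.K P.g0 _ U).trans (Real.exp_le_exp.mpr hE)

/-- **★ THE LOWER HALF OF (UV₁₃) AT `k = 0`, E-KEYED**: `E(P) ≤ e₋·|T^{(0)}| ⇒ χβ₀(U)·exp(−g₀⁻²·A^η₀(U) − (e₋ + 12·g₀⁻²)·|T^{(0)}|) ≤ ρ₀(U)` — `χβ₀ ∈ [0,1]` (K0e), `A^η₀ ≥ 0`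
(`wilsonBGOfRecord_nonneg`), `A(U) ≤ 12·|T^{(0)}|`; in the engines' currency (`g₀ = gOfRecord₁₃ θ P 0`). [B16] (0.1) p.356; [III] (2.50) p.264. -/
theorem uv_lower_zero_of_E_le_chi (hχ01 : ∀ (K : ℕ) (g : ℕ → ℝ) (k : ℕ) (V : GaugeField (F.P K) k (SU N)), χ K g k V ∈ Set.Icc (0 : ℝ) 1) {em : ℝ} (hE : EOfRecord₁₃Chi F N θ χ P ≤ em * (Fintype.card (Site (F.P P.K) 0) : ℝ)) (U : GaugeField (F.P P.K) 0 (SU N)) :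
    χ P.K (gOfRecord₁₃Chi F N θ χ P) 0 U *
        Real.exp (-(1 / (gOfRecord₁₃Chi F N θ χ P 0)) ^ 2 * wilsonBGOfRecord F N θ.εbg P 0 U
          - (em + 12 * (1 / P.g0) ^ 2) * (Fintype.card (Site (F.P P.K) 0) : ℝ)) ≤
      densOfRecord₁₃Chi F N θ χ P 0 U := by
  have hχ := hχ01 P.K (gOfRecord₁₃Chi F N θ χ P) 0 U
  have hχ0 : 0 ≤ χ P.K (gOfRecord₁₃Chi F N θ χ P) 0 U := hχ.1
  have hχ1 : χ P.K (gOfRecord₁₃Chi F N θ χ P) 0 U ≤ 1 := hχ.2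
  have hA : 0 ≤ wilsonBGOfRecord F N θ.εbg P 0 U := wilsonBGOfRecord_nonneg F N θ.εbg P 0 U
  have hA' : wilsonAction4 U ≤ 12 * (Fintype.card (Site (F.P P.K) 0) : ℝ) := wilsonAction4_le_twelve_mul_card_site U
  have hg0 : gOfRecord₁₃Chi F N θ χ P 0 = P.g0 := genSeq_zero _ _
  rw [hg0, densOfRecord₁₃_zero_apply_chi, ← Real.exp_add]
  have hsq : 0 ≤ (1 / P.g0) ^ 2 := sq_nonneg _
  have hcard : 0 ≤ (Fintype.card (Site (F.P P.K) 0) : ℝ) := Nat.cast_nonneg _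
  calc χ P.K (gOfRecord₁₃Chi F N θ χ P) 0 U *
          Real.exp (-(1 / P.g0) ^ 2 * wilsonBGOfRecord F N θ.εbg P 0 U - (em + 12 * (1 / P.g0) ^ 2) * (Fintype.card (Site (F.P P.K) 0) : ℝ))
      ≤ 1 * Real.exp (-(1 / P.g0) ^ 2 * wilsonBGOfRecord F N θ.εbg P 0 U - (em + 12 * (1 / P.g0) ^ 2) * (Fintype.card (Site (F.P P.K) 0) : ℝ)) :=
        mul_le_mul_of_nonneg_right hχ1 (Real.exp_pos _).le
    _ ≤ Real.exp (-(EOfRecord₁₃Chi F N θ χ P) + -(P.g0⁻¹ ^ 2) * wilsonAction4 U) := by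
        rw [one_mul]
        apply Real.exp_le_exp.mpr
        have h1 : -(1 / P.g0) ^ 2 * wilsonBGOfRecord F N θ.εbg P 0 U ≤ 0 := by
          have := mul_nonneg hsq hA
          linarith
        have h2 : P.g0⁻¹ ^ 2 * wilsonAction4 U ≤ (1 / P.g0) ^ 2 * (12 * (Fintype.card (Site (F.P P.K) 0) : ℝ)) := by
          rw [one_div]
          exact mul_le_mul_of_nonneg_left hA' (by rw [← one_div]; exact hsq)
        nlinarith [h1, h2, hE, mul_nonneg hsq hcard]

end EKeyedChi

/-! ## §2χ. Row (iv) ⟹ the coupling floor along the χ-generic run -/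

section FloorChi

/-- **ROW (iv) FORCES `0 ≤ M`** along the record's γ-windowed run (the empty sum at `(n, k) := (0, 0)`). [cite: Balaban1987RG1, Thm 2 p.259 (bookkeeping)] -/
theorem partialSumFloor_nonneg_of_inInterval_chi (θ : Stage13Params F N) (χ : ChiSlot F N) (P : B12.RunParams) {γ γ₀ M : ℝ} (hγ₀ : γ ≤ γ₀)
    (hps : ∀ (n : ℕ) (gs : ℕ → ℝ), RGEqH n (betaOfRecord₁₃Chi F N θ χ) gs → Step.InInterval γ₀ n gs →
      ∀ k, k ≤ n → -M ≤ ∑ j ∈ Finset.Ico k n, betaOfRecord₁₃Chi F N θ χ j (prefixOf gs j))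
    (hI : (genFlow (betaOfRecord₁₃Chi F N θ χ) P.g0).InInterval γ P.K) : 0 ≤ M := by
  have hrg : RGEqH 0 (betaOfRecord₁₃Chi F N θ χ) (genSeq (betaOfRecord₁₃Chi F N θ χ) P.g0) := fun k hk => absurd hk (Nat.not_lt_zero k)
  have hI0 : Step.InInterval γ₀ 0 (genSeq (betaOfRecord₁₃Chi F N θ χ) P.g0) :=
    fun i hi => ⟨(hI i (hi.trans (Nat.zero_le _))).1, (hI i (hi.trans (Nat.zero_le _))).2.trans hγ₀⟩
  have h := hps 0 _ hrg hI0 0 le_rfl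
  rw [Finset.Ico_self, Finset.sum_empty] at h
  linarith

/-- ★ **ALONG THE RECORD's RUN, ROW (iv) GIVES `g_j⁻² ≤ g₀⁻² + M` FOR EVERY `j ≤ K`** (γ-windowed run, `γ ≤ γ₀`): the run `gOfRecord₁₃ θ P = genSeq β_θ P.g₀` solves (0.20) on every horizon
`j ≤ K` while in the window (`B12NodeKnitIndAPlug.rgEqH_genSeq_of_inInterval`), lies in `]0, γ₀]` up to `j`, and the floor at `(n, k) := (j, 0)` applies (§1).  The UNIFORM-in-`j`
replacement of p590719's `g_j⁻² ≤ g₀⁻² + j·β′` (which read `β ≥ −β′` on the whole box). [cite: Balaban1987RG1, (0.18)–(0.20) pp.255–256, Thm 2 p.259, §1 pp.263–264] -/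
theorem inv_sq_gOfRecord₁₃_le_of_inInterval_of_runPartialSumFloor_chi (θ : Stage13Params F N) (χ : ChiSlot F N) (P : B12.RunParams) {γ γ₀ M : ℝ} (hγ₀ : γ ≤ γ₀)
    (hps : ∀ (n : ℕ) (gs : ℕ → ℝ), RGEqH n (betaOfRecord₁₃Chi F N θ χ) gs → Step.InInterval γ₀ n gs →
      ∀ k, k ≤ n → -M ≤ ∑ j ∈ Finset.Ico k n, betaOfRecord₁₃Chi F N θ χ j (prefixOf gs j))
    (hI : (genFlow (betaOfRecord₁₃Chi F N θ χ) P.g0).InInterval γ P.K) :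
    ∀ j, j ≤ P.K → (gOfRecord₁₃Chi F N θ χ P j ^ 2)⁻¹ ≤ (P.g0 ^ 2)⁻¹ + M := by
  intro j hj
  have hrg : RGEqH j (betaOfRecord₁₃Chi F N θ χ) (genSeq (betaOfRecord₁₃Chi F N θ χ) P.g0) :=
    rgEqH_genSeq_of_inInterval (betaOfRecord₁₃Chi F N θ χ) P hI hj
  have hIj : Step.InInterval γ₀ j (genSeq (betaOfRecord₁₃Chi F N θ χ) P.g0) :=
    fun i hi => ⟨(hI i (hi.trans hj)).1, (hI i (hi.trans hj)).2.trans hγ₀⟩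
  have h := inv_sq_le_inv_sq_zero_add_of_rgEqH_of_partialSumFloor hrg (hps j _ hrg hIj 0 (Nat.zero_le j))
  rw [genSeq_zero] at h
  exact h


end FloorChi

/-! ## §3χ. The normalisation letters ⟹ the E-bounds ⟹ (2.50) at level 0, χ-generic; the z-item bridges -/

section LettersChi

variable (θ : Stage13Params F N) (χ : ChiSlot F N) (P : B12.RunParams)

/-- Unfolding `e_j` with the `log z` volume factor rewritten as `|T₁^{(j)}| − |T₁^{(j+1)}|` (standing range `j < K`):
`e_j = (4·d(𝔤)·log g_j + 4·log σ₀ − logz_j)·(|T₁^{(j)}| − |T₁^{(j+1)}|) + Efl_j`. [cite: Balaban1988Convergent, (1.15) p.249; p.254] -/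
theorem eStepOfRecord_eq_of_lt_chi {j : ℕ} (hj : j < P.K) :
    eStepOfRecord N θ.ν (θ.Efl P) (θ.logz P) (gOfRecord₁₃Chi F N θ χ P) (F.P P.K) j =
      (4 * ((dimSU N : ℕ) : ℝ) * Real.log (gOfRecord₁₃Chi F N θ χ P j) + 4 * θ.ν.logσ₀ - θ.logz P j)
          * (sitesCard (F.P P.K) j - sitesCard (F.P P.K) (j + 1)) + θ.Efl P j := by
  have hΔ := sitesCard_sub_succ_eq (F := F) (K := P.K) (j := j) (by omega)
  unfold eStepOfRecord
  rw [← hΔ, tstarCount_eq_four_mul_sub]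
  ring

/-- **UPPER BOUND ON `e_j`** from the z-LOWER item `aL·log g_j − CzL ≤ logz_j` (`aL ≤ 4·d(𝔤)`) and the Efl-UPPER item `Efl_j ≤ CEU·|T₁^{(j+1)}|`, at a coupling `0 < g_j ≤ 1`:
`e_j ≤ (4·max(log σ₀, 0) + CzL)·(|T₁^{(j)}| − |T₁^{(j+1)}|) + CEU·|T₁^{(j+1)}|` (the logarithm `(4d(𝔤) − aL)·log g_j ≤ 0` is dropped).
[cite: Balaban1988Convergent, (1.15) p.249; Balaban1987RG1, (0.15) p.254, (2.13)–(2.14) p.268 (the shape of the items)] -/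
theorem eStepOfRecord_le_of_zLower_of_eflUpper_chi {j : ℕ} (hj : j < P.K)
    (hg : 0 < gOfRecord₁₃Chi F N θ χ P j ∧ gOfRecord₁₃Chi F N θ χ P j ≤ 1) {aL CzL CEU : ℝ} (haL : aL ≤ 4 * ((dimSU N : ℕ) : ℝ))
    (hzL : aL * Real.log (gOfRecord₁₃Chi F N θ χ P j) - CzL ≤ θ.logz P j) (hEU : θ.Efl P j ≤ CEU * sitesCard (F.P P.K) (j + 1)) :
    eStepOfRecord N θ.ν (θ.Efl P) (θ.logz P) (gOfRecord₁₃Chi F N θ χ P) (F.P P.K) j ≤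
      (4 * max θ.ν.logσ₀ 0 + CzL) * (sitesCard (F.P P.K) j - sitesCard (F.P P.K) (j + 1)) + CEU * sitesCard (F.P P.K) (j + 1) := by
  rw [eStepOfRecord_eq_of_lt_chi θ χ P hj]
  have hΔ : 0 ≤ sitesCard (F.P P.K) j - sitesCard (F.P P.K) (j + 1) := sitesCard_sub_succ_nonneg (F := F) (by omega)
  have hlog : Real.log (gOfRecord₁₃Chi F N θ χ P j) ≤ 0 := Real.log_nonpos hg.1.le hg.2
  have h1 : (4 * ((dimSU N : ℕ) : ℝ) - aL) * Real.log (gOfRecord₁₃Chi F N θ χ P j) ≤ 0 :=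
    mul_nonpos_of_nonneg_of_nonpos (by linarith) hlog
  have hcoef : 4 * ((dimSU N : ℕ) : ℝ) * Real.log (gOfRecord₁₃Chi F N θ χ P j) + 4 * θ.ν.logσ₀ - θ.logz P j ≤ 4 * max θ.ν.logσ₀ 0 + CzL := by
    linarith [le_max_left θ.ν.logσ₀ 0]
  have := mul_le_mul_of_nonneg_right hcoef hΔ
  linarith

/-- **UPPER BOUND ON `−e_j`** from the z-UPPER item `logz_j ≤ aU·log g_j + CzU` (`aU ≤ 4·d(𝔤)`), the Efl-LOWER item `−CEL·|T₁^{(j+1)}| ≤ Efl_j` and a logarithmic ceiling `log g_j⁻¹ ≤ ℓ`: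
`−e_j ≤ ((4d(𝔤) − aU)·ℓ + 4·max(−log σ₀, 0) + CzU)·(|T₁^{(j)}| − |T₁^{(j+1)}|) + CEL·|T₁^{(j+1)}|`.
[cite: Balaban1988Convergent, (1.15) p.249; Balaban1987RG1, (0.15) p.254, (2.13)–(2.14) p.268 (the shape of the items)] -/
theorem neg_eStepOfRecord_le_of_zUpper_of_eflLower_chi {j : ℕ} (hj : j < P.K) {aU CzU CEL ℓ : ℝ} (haU : aU ≤ 4 * ((dimSU N : ℕ) : ℝ))
    (hzU : θ.logz P j ≤ aU * Real.log (gOfRecord₁₃Chi F N θ χ P j) + CzU) (hEL : -(CEL * sitesCard (F.P P.K) (j + 1)) ≤ θ.Efl P j)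
    (hℓ : Real.log (gOfRecord₁₃Chi F N θ χ P j)⁻¹ ≤ ℓ) :
    -(eStepOfRecord N θ.ν (θ.Efl P) (θ.logz P) (gOfRecord₁₃Chi F N θ χ P) (F.P P.K) j) ≤
      ((4 * ((dimSU N : ℕ) : ℝ) - aU) * ℓ + 4 * max (-θ.ν.logσ₀) 0 + CzU) * (sitesCard (F.P P.K) j - sitesCard (F.P P.K) (j + 1))
        + CEL * sitesCard (F.P P.K) (j + 1) := by
  rw [eStepOfRecord_eq_of_lt_chi θ χ P hj]
  have hΔ : 0 ≤ sitesCard (F.P P.K) j - sitesCard (F.P P.K) (j + 1) := sitesCard_sub_succ_nonneg (F := F) (by omega)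
  rw [Real.log_inv] at hℓ
  have h1 : (4 * ((dimSU N : ℕ) : ℝ) - aU) * (-Real.log (gOfRecord₁₃Chi F N θ χ P j)) ≤ (4 * ((dimSU N : ℕ) : ℝ) - aU) * ℓ :=
    mul_le_mul_of_nonneg_left hℓ (by linarith)
  have hcoef : -(4 * ((dimSU N : ℕ) : ℝ) * Real.log (gOfRecord₁₃Chi F N θ χ P j) + 4 * θ.ν.logσ₀ - θ.logz P j)
      ≤ (4 * ((dimSU N : ℕ) : ℝ) - aU) * ℓ + 4 * max (-θ.ν.logσ₀) 0 + CzU := by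
    linarith [le_max_left (-θ.ν.logσ₀) 0]
  have := mul_le_mul_of_nonneg_right hcoef hΔ
  linarith





/-- ★ **`E(P) ≤ (4·max(log σ₀,0) + CzL + CEU)·|T₁^{(0)}|` ALONG A γ-WINDOWED RUN** (`0 < g_j ≤ γ ≤ 1`), from the z-LOWER item (`aL ≤ 4d(𝔤)`, `0 ≤ CzL`) and the Efl-UPPER item
(`0 ≤ CEU`) at every step `j < K`: sum §2 over the scales, telescope `Σ_j (|T₁^{(j)}| − |T₁^{(j+1)}|) = |T₁^{(0)}| − |T₁^{(K)}|`, `Σ_j |T₁^{(j+1)}| ≤ |T₁^{(0)}|∕15`.  The coupling-blind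
class (`logz = Efl = 0`: `aL = CzL = CEU = 0`) recovers p586609's `E ≤ 4·max(log σ₀,0)·|T₁^{(0)}|`. [cite: Balaban1988Convergent, Thm 1 p.262, (1.15) p.249; Balaban1987RG1, (0.15) p.254] -/
theorem EOfRecord₁₃_le_of_inInterval_of_zLower_of_eflUpper_chi {γ : ℝ} (hγ : γ ≤ 1) (hI : (genFlow (betaOfRecord₁₃Chi F N θ χ) P.g0).InInterval γ P.K)
    {aL CzL CEU : ℝ} (haL : aL ≤ 4 * ((dimSU N : ℕ) : ℝ)) (hCzL : 0 ≤ CzL) (hCEU : 0 ≤ CEU)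
    (hzL : ∀ j, j < P.K → aL * Real.log (gOfRecord₁₃Chi F N θ χ P j) - CzL ≤ θ.logz P j)
    (hEU : ∀ j, j < P.K → θ.Efl P j ≤ CEU * sitesCard (F.P P.K) (j + 1)) :
    EOfRecord₁₃Chi F N θ χ P ≤ (4 * max θ.ν.logσ₀ 0 + CzL + CEU) * (Fintype.card (Site (F.P P.K) 0) : ℝ) := by
  have hE : EOfRecord₁₃Chi F N θ χ P = ∑ j ∈ Finset.range P.K, eStepOfRecord N θ.ν (θ.Efl P) (θ.logz P) (gOfRecord₁₃Chi F N θ χ P) (F.P P.K) j := rfl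
  have hstep : ∀ j ∈ Finset.range P.K, eStepOfRecord N θ.ν (θ.Efl P) (θ.logz P) (gOfRecord₁₃Chi F N θ χ P) (F.P P.K) j ≤
      (4 * max θ.ν.logσ₀ 0 + CzL) * (sitesCard (F.P P.K) j - sitesCard (F.P P.K) (j + 1)) + CEU * sitesCard (F.P P.K) (j + 1) := by
    intro j hjm
    have hj : j < P.K := Finset.mem_range.mp hjm
    exact eStepOfRecord_le_of_zLower_of_eflUpper_chi θ χ P hj ⟨(hI j hj.le).1, (hI j hj.le).2.trans hγ⟩ haL (hzL j hj) (hEU j hj)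
  rw [hE]
  refine (Finset.sum_le_sum hstep).trans ?_
  rw [Finset.sum_add_distrib, ← Finset.mul_sum, ← Finset.mul_sum, Finset.sum_range_sub' (fun j => sitesCard (F.P P.K) j) P.K]
  have hsucc := sum_sitesCard_succ_range_le (F := F) P.K
  have hK : 0 ≤ sitesCard (F.P P.K) P.K := Nat.cast_nonneg _
  have h0 : 0 ≤ sitesCard (F.P P.K) 0 := Nat.cast_nonneg _
  have hm : 0 ≤ 4 * max θ.ν.logσ₀ 0 + CzL := by linarith [le_max_right θ.ν.logσ₀ 0]
  rw [← show sitesCard (F.P P.K) 0 = (Fintype.card (Site (F.P P.K) 0) : ℝ) from rfl]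
  nlinarith [mul_le_mul_of_nonneg_left hsucc hCEU, hm, hK, h0]

/-- ★ **`−E(P) ≤ ((4d(𝔤) − aU)·(log g₀⁻¹ + M∕2) + 4·max(−log σ₀,0) + CzU + CEL)·|T₁^{(0)}|` ALONG A γ-WINDOWED RUN WHOSE COUPLINGS OBEY THE FLOOR `g_j⁻² ≤ g₀⁻² + M`** (`γ ≤ 1`,
`0 ≤ M`; the floor is K1⁹'s row (iv) read along the run, p632548 §1), from the z-UPPER item (`aU ≤ 4d(𝔤)`, `0 ≤ CzU`) and the Efl-LOWER item (`0 ≤ CEL`) at every step `j < K`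
(`log g_j⁻¹ ≤ log g₀⁻¹ + M∕2` by p590719's logarithmic step).  With `aU = 0 = CzU = CEL` this is p632548 §2 (coefficient `4d(𝔤)`); with the Laplace-sharp `aU = d(𝔤)` the
coefficient is the Gaussian `3d(𝔤)`. [cite: Balaban1988Convergent, Thm 1 p.262, (1.15) p.249; Balaban1987RG1, (0.15) p.254, (0.20) p.256] -/
theorem neg_EOfRecord₁₃_le_of_inInterval_of_invSqFloor_of_zUpper_of_eflLower_chi {γ M : ℝ} (hγ : γ ≤ 1) (hM : 0 ≤ M)
    (hfl : ∀ j, j ≤ P.K → (gOfRecord₁₃Chi F N θ χ P j ^ 2)⁻¹ ≤ (P.g0 ^ 2)⁻¹ + M)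
    (hI : (genFlow (betaOfRecord₁₃Chi F N θ χ) P.g0).InInterval γ P.K)
    {aU CzU CEL : ℝ} (haU : aU ≤ 4 * ((dimSU N : ℕ) : ℝ)) (hCzU : 0 ≤ CzU) (hCEL : 0 ≤ CEL)
    (hzU : ∀ j, j < P.K → θ.logz P j ≤ aU * Real.log (gOfRecord₁₃Chi F N θ χ P j) + CzU)
    (hEL : ∀ j, j < P.K → -(CEL * sitesCard (F.P P.K) (j + 1)) ≤ θ.Efl P j) :
    -(EOfRecord₁₃Chi F N θ χ P) ≤
      ((4 * ((dimSU N : ℕ) : ℝ) - aU) * (Real.log P.g0⁻¹ + M / 2) + 4 * max (-θ.ν.logσ₀) 0 + CzU + CEL) * (Fintype.card (Site (F.P P.K) 0) : ℝ) := by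
  have hE : EOfRecord₁₃Chi F N θ χ P = ∑ j ∈ Finset.range P.K, eStepOfRecord N θ.ν (θ.Efl P) (θ.logz P) (gOfRecord₁₃Chi F N θ χ P) (F.P P.K) j := rfl
  have hg0eq : gOfRecord₁₃Chi F N θ χ P 0 = P.g0 := genSeq_zero _ _
  have hg0pos : 0 < P.g0 := hg0eq ▸ (hI 0 (Nat.zero_le _)).1
  have hg0le : P.g0 ≤ 1 := hg0eq ▸ ((hI 0 (Nat.zero_le _)).2.trans hγ)
  have hlog0 : 0 ≤ Real.log P.g0⁻¹ := Real.log_nonneg ((one_le_inv₀ hg0pos).mpr hg0le)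
  have hstep : ∀ j ∈ Finset.range P.K, -(eStepOfRecord N θ.ν (θ.Efl P) (θ.logz P) (gOfRecord₁₃Chi F N θ χ P) (F.P P.K) j) ≤
      ((4 * ((dimSU N : ℕ) : ℝ) - aU) * (Real.log P.g0⁻¹ + M / 2) + 4 * max (-θ.ν.logσ₀) 0 + CzU) * (sitesCard (F.P P.K) j - sitesCard (F.P P.K) (j + 1))
        + CEL * sitesCard (F.P P.K) (j + 1) := by
    intro j hjm
    have hj : j < P.K := Finset.mem_range.mp hjm
    exact neg_eStepOfRecord_le_of_zUpper_of_eflLower_chi θ χ P hj haU (hzU j hj) (hEL j hj)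
      (log_inv_le_log_inv_add_of_inv_sq_le (hI j hj.le).1 hg0pos hg0le hM (hfl j hj.le))
  rw [hE, ← Finset.sum_neg_distrib]
  refine (Finset.sum_le_sum hstep).trans ?_
  rw [Finset.sum_add_distrib, ← Finset.mul_sum, ← Finset.mul_sum, Finset.sum_range_sub' (fun j => sitesCard (F.P P.K) j) P.K]
  have hsucc := sum_sitesCard_succ_range_le (F := F) P.K
  have hK : 0 ≤ sitesCard (F.P P.K) P.K := Nat.cast_nonneg _
  have h0 : 0 ≤ sitesCard (F.P P.K) 0 := Nat.cast_nonneg _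
  have hm : 0 ≤ (4 * ((dimSU N : ℕ) : ℝ) - aU) * (Real.log P.g0⁻¹ + M / 2) + 4 * max (-θ.ν.logσ₀) 0 + CzU := by
    have : 0 ≤ (4 * ((dimSU N : ℕ) : ℝ) - aU) * (Real.log P.g0⁻¹ + M / 2) := mul_nonneg (by linarith) (by linarith)
    linarith [le_max_right (-θ.ν.logσ₀) 0]
  rw [← show sitesCard (F.P P.K) 0 = (Fintype.card (Site (F.P P.K) 0) : ℝ) from rfl]
  nlinarith [mul_le_mul_of_nonneg_left hsucc hCEL, hm, hK, h0]





/-- **★★ THE LEVEL-`0` CONJUNCT OF N13's (UV₁₃) ROW, BOTH SIDES, UNDER THE FOUR NORMALISATION ITEMS AND THE COUPLING FLOOR** (`γ ≤ 1`, `0 ≤ M`, `g_j⁻² ≤ g₀⁻² + M`):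
`χβ₀·exp(−g₀⁻²·A^η₀ − em·|T₁^{(0)}|) ≤ ρ₀ ≤ exp(ep·|T₁^{(0)}|)` with `em = 4·max(log σ₀,0) + CzL + CEU + 12·g₀⁻²` and `ep = (4d(𝔤) − aU)·(log g₀⁻¹ + M∕2) + 4·max(−log σ₀,0) + CzU + CEL`
— functions of `g₀ = g_k|_{k=0}` and the item constants alone.  p632548 §3 is the instance `a = C = 0`.
[cite: Balaban1989LargeFieldII, (0.1) pp.355–356; Balaban1988Convergent, Cor. 3 (2.50) p.264, Thm 1 p.262, (1.15) p.249; Balaban1987RG1, (0.15) p.254, (0.20) p.256] -/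
theorem uv_zero_densOfRecord₁₃_of_normLetters_of_inInterval_of_invSqFloor_chi (hχ01 : ∀ (K : ℕ) (g : ℕ → ℝ) (k : ℕ) (V : GaugeField (F.P K) k (SU N)), χ K g k V ∈ Set.Icc (0 : ℝ) 1) {γ M : ℝ} (hγ : γ ≤ 1) (hM : 0 ≤ M)
    (hfl : ∀ j, j ≤ P.K → (gOfRecord₁₃Chi F N θ χ P j ^ 2)⁻¹ ≤ (P.g0 ^ 2)⁻¹ + M)
    (hI : (genFlow (betaOfRecord₁₃Chi F N θ χ) P.g0).InInterval γ P.K)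
    {aL aU CzL CzU CEL CEU : ℝ} (haL : aL ≤ 4 * ((dimSU N : ℕ) : ℝ)) (haU : aU ≤ 4 * ((dimSU N : ℕ) : ℝ))
    (hCzL : 0 ≤ CzL) (hCzU : 0 ≤ CzU) (hCEL : 0 ≤ CEL) (hCEU : 0 ≤ CEU)
    (hzL : ∀ j, j < P.K → aL * Real.log (gOfRecord₁₃Chi F N θ χ P j) - CzL ≤ θ.logz P j)
    (hzU : ∀ j, j < P.K → θ.logz P j ≤ aU * Real.log (gOfRecord₁₃Chi F N θ χ P j) + CzU)
    (hEL : ∀ j, j < P.K → -(CEL * sitesCard (F.P P.K) (j + 1)) ≤ θ.Efl P j)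
    (hEU : ∀ j, j < P.K → θ.Efl P j ≤ CEU * sitesCard (F.P P.K) (j + 1))
    (U : GaugeField (F.P P.K) 0 (SU N)) :
    χ P.K (gOfRecord₁₃Chi F N θ χ P) 0 U *
          Real.exp (-(1 / (gOfRecord₁₃Chi F N θ χ P 0)) ^ 2 * wilsonBGOfRecord F N θ.εbg P 0 U
            - (4 * max θ.ν.logσ₀ 0 + CzL + CEU + 12 * (1 / gOfRecord₁₃Chi F N θ χ P 0) ^ 2) * (Fintype.card (Site (F.P P.K) 0) : ℝ)) ≤ densOfRecord₁₃Chi F N θ χ P 0 U ∧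
      densOfRecord₁₃Chi F N θ χ P 0 U ≤
        Real.exp (((4 * ((dimSU N : ℕ) : ℝ) - aU) * (Real.log (gOfRecord₁₃Chi F N θ χ P 0)⁻¹ + M / 2) + 4 * max (-θ.ν.logσ₀) 0 + CzU + CEL)
          * (Fintype.card (Site (F.P P.K) 0) : ℝ)) := by
  have hg0 : gOfRecord₁₃Chi F N θ χ P 0 = P.g0 := genSeq_zero _ _
  refine ⟨?_, ?_⟩
  · have h := uv_lower_zero_of_E_le_chi θ χ P hχ01 (EOfRecord₁₃_le_of_inInterval_of_zLower_of_eflUpper_chi θ χ P hγ hI haL hCzL hCEU hzL hEU) U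
    rw [hg0] at h ⊢
    exact h
  · rw [hg0]
    exact uv_upper_zero_of_negE_le_chi θ χ P (neg_EOfRecord₁₃_le_of_inInterval_of_invSqFloor_of_zUpper_of_eflLower_chi θ χ P hγ hM hfl hI haU hCzU hCEL hzU hEL) U



/-- ★ **PRINT's `z` OF [I] (0.15) MEETS BOTH z-ITEMS ON EVERY γ-WINDOWED RUN** (`γ ≤ 1`): if the witness's letter `logz_j` IS `log z(g_j², ε₀)` on `SU(N)` (the reader's identification `α = g_j²` of
(0.17)∕(0.19)), then the z-LOWER item holds with print's coefficient `aL = d(𝔤)` and `CzL = C_z^{SU}(N, ε₀)` (the tree's KERNEL theorem `B16ZLower.log_zNorm_specialUnitaryGroup_ge`) and the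
z-UPPER item holds trivially with `aU = CzU = 0` (`z ≤ 1`).  So such a witness is NOT coupling-blind and §3–§4 apply to it with `−E`'s `|T₁^{(0)}|·log g₀⁻¹` coefficient `4d(𝔤)`.
[cite: Balaban1987RG1, (0.14)–(0.17) pp.254–255] -/
theorem zItems_of_logz_eq_log_zNorm_chi {ε₀ : ℝ} (hε : 0 < ε₀)
    (hz : ∀ j, j < P.K → θ.logz P j = Real.log (B16ZLower.zNorm (SU N) (gOfRecord₁₃Chi F N θ χ P j ^ 2) ε₀))
    {γ : ℝ} (hγ : γ ≤ 1) (hI : (genFlow (betaOfRecord₁₃Chi F N θ χ) P.g0).InInterval γ P.K) :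
    (∀ j, j < P.K → ((dimSU N : ℕ) : ℝ) * Real.log (gOfRecord₁₃Chi F N θ χ P j) - B16ZLower.CzSU N ε₀ ≤ θ.logz P j) ∧
      (∀ j, j < P.K → θ.logz P j ≤ (0 : ℝ) * Real.log (gOfRecord₁₃Chi F N θ χ P j) + 0) := by
  refine ⟨fun j hj => ?_, fun j hj => ?_⟩
  · have hg := hI j hj.le
    rw [hz j hj, dimSU_cast]
    exact B16ZLower.log_zNorm_specialUnitaryGroup_ge (N := N) hg.1 (hg.2.trans hγ) hε
  · have hg := hI j hj.le
    rw [hz j hj, zero_mul, zero_add]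
    exact log_zNorm_SU_nonpos hg.1 ε₀

/-- ★★ **(2.50) AT LEVEL `0` AT A WITNESS WHOSE `logz` IS PRINT's `z` AND WHOSE `Efl` IS VOLUME-BOUNDED** (`|Efl_j| ≤ C_E·|T₁^{(j+1)}|`, the [I] (2.13)–(2.14) p.268 shape), along a γ-windowed run
(`γ ≤ 1`) under the coupling floor: both sides with `em = 4·max(log σ₀,0) + C_z^{SU}(N,ε₀) + C_E + 12·g₀⁻²`, `ep = 4d(𝔤)·(log g₀⁻¹ + M∕2) + 4·max(−log σ₀,0) + C_E`.
[cite: Balaban1989LargeFieldII, (0.1) pp.355–356; Balaban1988Convergent, (2.50) p.264, Thm 1 p.262, (1.15) p.249; Balaban1987RG1, (0.15) p.254, (2.13)–(2.14) p.268, (0.20) p.256] -/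
theorem uv_zero_densOfRecord₁₃_of_logz_zNorm_of_eflAbs_of_inInterval_of_invSqFloor_chi (hχ01 : ∀ (K : ℕ) (g : ℕ → ℝ) (k : ℕ) (V : GaugeField (F.P K) k (SU N)), χ K g k V ∈ Set.Icc (0 : ℝ) 1) {γ M ε₀ CE : ℝ} (hγ : γ ≤ 1) (hM : 0 ≤ M) (hε : 0 < ε₀) (hCE : 0 ≤ CE)
    (hfl : ∀ j, j ≤ P.K → (gOfRecord₁₃Chi F N θ χ P j ^ 2)⁻¹ ≤ (P.g0 ^ 2)⁻¹ + M)
    (hI : (genFlow (betaOfRecord₁₃Chi F N θ χ) P.g0).InInterval γ P.K)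
    (hz : ∀ j, j < P.K → θ.logz P j = Real.log (B16ZLower.zNorm (SU N) (gOfRecord₁₃Chi F N θ χ P j ^ 2) ε₀))
    (hE : ∀ j, j < P.K → |θ.Efl P j| ≤ CE * sitesCard (F.P P.K) (j + 1))
    (U : GaugeField (F.P P.K) 0 (SU N)) :
    χ P.K (gOfRecord₁₃Chi F N θ χ P) 0 U *
          Real.exp (-(1 / (gOfRecord₁₃Chi F N θ χ P 0)) ^ 2 * wilsonBGOfRecord F N θ.εbg P 0 U
            - (4 * max θ.ν.logσ₀ 0 + B16ZLower.CzSU N ε₀ + CE + 12 * (1 / gOfRecord₁₃Chi F N θ χ P 0) ^ 2) * (Fintype.card (Site (F.P P.K) 0) : ℝ)) ≤ densOfRecord₁₃Chi F N θ χ P 0 U ∧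
      densOfRecord₁₃Chi F N θ χ P 0 U ≤
        Real.exp ((4 * ((dimSU N : ℕ) : ℝ) * (Real.log (gOfRecord₁₃Chi F N θ χ P 0)⁻¹ + M / 2) + 4 * max (-θ.ν.logσ₀) 0 + CE)
          * (Fintype.card (Site (F.P P.K) 0) : ℝ)) := by
  have hz2 := zItems_of_logz_eq_log_zNorm_chi θ χ P hε hz hγ hI
  have hd : (0 : ℝ) ≤ 4 * ((dimSU N : ℕ) : ℝ) := by have : (0 : ℝ) ≤ ((dimSU N : ℕ) : ℝ) := Nat.cast_nonneg _; linarith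
  have h := uv_zero_densOfRecord₁₃_of_normLetters_of_inInterval_of_invSqFloor_chi θ χ P hχ01 hγ hM hfl hI dimSU_le_four_mul hd
    (B16ZLower.CzSU_nonneg (N := N) hε) le_rfl hCE hCE hz2.1 hz2.2
    (fun j hj => by have := hE j hj; have := neg_abs_le (θ.Efl P j); linarith) (fun j hj => (le_abs_self _).trans (hE j hj)) U
  refine ⟨h.1, ?_⟩
  convert h.2 using 3
  ring


end LettersChi

end Summit.QuantumFields.YangMills.BalabanUVNodes.N13UV01LevelZeroAtRecord13Chi

end
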